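/-
Copyright (c) 2026 the pub-hodgecm-mathlib formalisation cell (harness21).  Prover seat hodgecm-mathlib-K2E1-p10 (g6), Track B ∕ K2-LIT, h413 =
`stmt-HodgeConjecture-24833`, route `HCCMUnconditional`; R90-TF S8 «ContSpec-n½», (M) road RES-INT (M-a) OF RECORD (census
`K2/K2E1-p10/g6/CENSUS-RES-INT-Ma.K2E1-p10-g6.md` e19e192b71e365b5, S8 dealer R90-CS-plan (g3) S8-R226 «KER file NOW»), lines 4–5 «KER».
-/
import Summits.HodgeConjecture.HodgeConjecture.Theorems.R90S8ResidueConstantTermOfExportsU3     -- ★ p864590 CT-RES `borelConstantTerm_midPoleLetter_eq`, `continuous_midPoleLetter_apply`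
import Summits.HodgeConjecture.HodgeConjecture.Theorems.K2E1ResidualAdmissibleOfExponents      -- ★ `constantTermVanishes_of_setIntegral_eq_zero` ((E2): ONE vanishing constant term gives them all); brings ★ `residualSubspace`
import Summits.HodgeConjecture.HodgeConjecture.Theorems.K2E1HeisenbergRadicalCocompactU3        -- ★ `exists_isCompact_rational_smul_mem_of_eq_three` (compact fundamental SET of `N(F)` in `N(𝔸)`)
import Summits.HodgeConjecture.HodgeConjecture.Theorems.K2E1HeisenbergHaarU3                    -- ★ `locallyCompactSpace_and_secondCountableTopology_adelicUnipotent`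
import Literature.NumberTheory.Automorphic.AutomorphicRepsGLCuspidalUnitary                      -- ★ `AdelicGroupData.quotFun`, `quotFun_toAutomorphicQuotient`, `continuous_quotFun`
import Literature.NumberTheory.Automorphic.UnitaryGroupKernelClassOrbitalUnfolding              -- ★ `countable_arithmeticSubgroup_quasiSplit`
import HarnessLib

/-!
# R90 · S8 «ContSpec-n½» — `R90S8ResidueMapKernelU3`: «KER» — A RESIDUAL CLASS WITH VANISHING BOREL CONSTANT TERM IS ZERO, and the residue class at the middle pole vanishes
# iff `ρψ = ρ·φt(3∕2) = 0` (RES-INT (M-a) OF RECORD, lines 4–5) [MoeglinWaldspurger1995 I.2.18, IV.1.11, V.3.13; Langlands1976 §7]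

Cell `pub/hodgecm-mathlib`, crux H413 = `stmt-HodgeConjecture-24833` (lane `--kind proof --supports stmt-HodgeConjecture-24833 --as helper`), route of record
`HCCMUnconditional`; programme R90-TF, section S8, the (M) socket road RES-INT (M-a) (census e19e192b71e365b5 = THE RES-INT ROAD OF RECORD, S8-R226).  THEOREMS ONLY: no `def`,
no `instance`, no `notation`, no named-fact hypothesis, no `sorry`, NO `Lines` import; default heartbeats.  CLOSES NO SOCKET.

THE MATHEMATICS.  Let `Φ : G(𝔸) → ℂ` (`G = U(J₃)`, Mok's `quasiSplit L⁺ L c 3`) be continuous and left-invariant under `A_G·G(F)` (★ `quasiSplit.quotientSubgroup`), e.g. the residue function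
`g ↦ Fp g (3∕2)` of a middle-pole generator (continuity ★ p864590 `continuous_midPoleLetter_apply`, invariance ★ `midPoleLetter_apply_quotientSubgroup_mul`), and let `f ∈ L²(G(F)∖G(𝔸))` be
its class (`f =ᵐ x ↦ Φ((out x)⁻¹)`, D1's `hf`).  (§1–§2) If the Borel constant term `(ν𝓕)⁻¹∫_𝓕 Φ(u g) dν(u)` vanishes for ONE Heisenberg package (`ν` Haar on `N(𝔸)`, `𝓕` a fundamental
domain of `N(F)` with `0 < ν𝓕 < ∞`) and all `g`, then the descent `quotFun Φ` is a continuous square-integrable CUSP FORM along every parabolic datum whose radicals are `N(𝔸)` (★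
`constantTermVanishes_of_setIntegral_eq_zero`: one vanishing constant term gives them all — Haar uniqueness + ★ fundamental-domain transport; compact fundamental set ★
`exists_isCompact_rational_smul_mem_of_eq_three`), so `f ∈ L²_cusp` (★ `toLp_mem_cuspidalSubspace`).  (§3) If moreover `f ∈ L²_res = L²_disc ⊓ (L²_cusp)ᗮ` — the (R)′ conclusion
`resGMidBlock ≤ residualSubspace μ 𝔓` applied to a generator — then `⟪f, f⟫ = 0` (★ `isOrtho_cuspidalSubspace_residualSubspace`, the three lines of ★ `cuspidal_residual_exclusive`), i.e.
`f = 0`: **KER ⊇**.  (§4) With ★ CT-RES (`CT(Φ)(g) = ρψ g·H(g)^{2−3∕2}`): `ρψ = 0 ⇒ f = 0`, and conversely `f = 0 ⇒ Φ = 0` (continuity, `μ` positive on opens) `⇒ CT(Φ) = 0 ⇒ ρψ = 0`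
(`H(g) > 0`): **`f = 0 ↔ ρψ = 0`** — «`ker Res = ker M₋₁`» at one generator, `M₋₁φ := ρψ = ρ·φt(3∕2)`.

## CONTENTS (namespace `Summit.HodgeConjecture.HodgeConjecture.R90.S8`)
* §1 `constantTermVanishes_quotFun_of_borelConstantTerm_eq_zero` — ONE package with `CT(Φ) = 0` ⇒ ★ `ConstantTermVanishes 𝔓 (quotFun Φ) j` at every radical `= N(𝔸)`.
* §2 `toLp_quotFun_mem_cuspidalSubspace_of_borelConstantTerm_eq_zero` — + `MemLp` ⇒ the class lies in `L²_cusp(𝔓)`.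
* §3 **`res_class_eq_zero_of_borelConstantTerm_eq_zero`** — KER ⊇ (generic `Φ`): + `f =ᵐ quotFun Φ`, `f ∈ L²_res(𝔓)` ⇒ `f = 0`.
* §4 **`res_class_eq_zero_iff_rhoPsi_eq_zero`** — the RES-INT kernel statement at one generator, hypothesis-first on T's clauses + D1's pole letter + ℓ-CT's package (★ CT-RES's binders
  byte for byte) + the (R)′ conclusion as the binder `hres : f ∈ residualSubspace μ 𝔓`: `f = 0 ↔ ∀ g, ρψ g = 0`.
HONEST LABEL: HC_CM is proved only modulo the 7 printed citations (2 remaining named inputs: hLiu418 = `stmt-HodgeConjecture-24832`, h413 = `stmt-HodgeConjecture-24833`) until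
rung 0 closes; REL ≠ ★ ≠ BUILT; conditional by construction on the (R)′ membership `hres` and on T's ∕ ℓ-CT's ★-shaped letters; pays no socket; count-neutral.

## References
* [MoeglinWaldspurger1995] C. Mœglin, J.-L. Waldspurger, *Spectral Decomposition and Eisenstein Series* (1995), I.2.6, I.2.18, IV.1.9–IV.1.11, V.3.13.
* [Langlands1976] R. P. Langlands, *On the Functional Equations Satisfied by Eisenstein Series*, LNM 544 (1976), §7.
* [BorelJacquet1979] A. Borel, H. Jacquet, *Automorphic forms and automorphic representations*, Proc. Sympos. Pure Math. 33.1 (1979), §4.4–§4.6.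
* [Rogawski1990] J. D. Rogawski, *Automorphic Representations of Unitary Groups in Three Variables* (1990), §2.1, §13.9 p. 229 (ii).
-/

set_option autoImplicit false
-- the mandated namespace repeats the single-problem summit's segment (`HodgeConjecture.HodgeConjecture`)
set_option linter.dupNamespace false

noncomputable section

open MeasureTheory Measure Set Filter Topology NumberField
open Literature.NumberTheory.Automorphic Literature.NumberTheory.Automorphic.UnitaryGroup Literature.NumberTheory.GaloisRepresentations AdelicGroupData
open Summit.HodgeConjecture.HodgeConjecture.Cruxes.H413.K2E1CuspidalSpectrumUnitary
open Summit.HodgeConjecture.HodgeConjecture.Cruxes.H413.K2E1ResidualAdmissibleOfExponents (constantTermVanishes_of_setIntegral_eq_zero)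
open Summit.HodgeConjecture.HodgeConjecture.Cruxes.H413.K2E1HeisenbergRadicalCocompactU3 (exists_isCompact_rational_smul_mem_of_eq_three)
open Summit.HodgeConjecture.HodgeConjecture.Cruxes.H413.K2E1HeisenbergHaarU3 (locallyCompactSpace_and_secondCountableTopology_adelicUnipotent)
open scoped ENNReal NNReal

namespace Summit.HodgeConjecture.HodgeConjecture.R90.S8

variable (L : Type) [Field L] [NumberField L] [IsCMField L]
  [MeasurableSpace (quasiSplit (↥(maximalRealSubfield L)) L (IsCMField.complexConj L) 3).Adelic] [BorelSpace (quasiSplit (↥(maximalRealSubfield L)) L (IsCMField.complexConj L) 3).Adelic]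

/-! ## §1 One vanishing Borel constant term ⇒ the descent is a cusp form along every radical `= N(𝔸)` -/

/-- **ONE VANISHING BOREL CONSTANT TERM GIVES ★ `ConstantTermVanishes` AT EVERY RADICAL `= N(𝔸)`.**  `Φ` continuous and left-`A_G·G(F)`-invariant on `U(J₃)(𝔸_{L⁺})`; ONE Haar
measure `ν₀` of `N(𝔸)` and ONE fundamental domain `𝓕₀` of `N(F)` with `ν₀ 𝓕₀ ≠ 0, ∞` and `borelConstantTerm ν₀ 𝓕₀ Φ g = 0` for all `g`.  Then for every parabolic datum `𝔓` and index `j`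
with `𝔓.radical j = N(𝔸)`: `ConstantTermVanishes 𝔓 (quotFun Φ) j` — `quotFun Φ [x u⁻¹] = Φ(u x⁻¹)` (★ `quotFun_toAutomorphicQuotient`), so the hypothesis is the vanishing of ONE constant
term of the descent, and ★ `constantTermVanishes_of_setIntegral_eq_zero` (Haar uniqueness + fundamental-domain transport, over the compact fundamental SET ★
`exists_isCompact_rational_smul_mem_of_eq_three`, `N(F)` countable ★ `countable_arithmeticSubgroup_quasiSplit`, `N(𝔸)` locally compact second countable ★) gives them all.
[cite: BorelJacquet1979, §4.4] [cite: MoeglinWaldspurger1995, I.2.6] -/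
theorem constantTermVanishes_quotFun_of_borelConstantTerm_eq_zero
    {Φ : (quasiSplit (↥(maximalRealSubfield L)) L (IsCMField.complexConj L) 3).Adelic → ℂ} (hΦc : Continuous Φ)
    (hΦinv : ∀ γ ∈ (quasiSplit (↥(maximalRealSubfield L)) L (IsCMField.complexConj L) 3).quotientSubgroup,
      ∀ g : (quasiSplit (↥(maximalRealSubfield L)) L (IsCMField.complexConj L) 3).Adelic, Φ (γ * g) = Φ g)
    (ν₀ : Measure ↥(adelicUnipotent (↥(maximalRealSubfield L)) L (IsCMField.complexConj L) 3)) [ν₀.IsHaarMeasure]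
    {𝓕₀ : Set ↥(adelicUnipotent (↥(maximalRealSubfield L)) L (IsCMField.complexConj L) 3)}
    (h𝓕₀ : IsFundamentalDomain ↥(rationalUnipotent (↥(maximalRealSubfield L)) L (IsCMField.complexConj L) 3) 𝓕₀ ν₀) (h𝓕₀0 : ν₀ 𝓕₀ ≠ 0) (h𝓕₀top : ν₀ 𝓕₀ ≠ ∞)
    (hCT : ∀ g : (quasiSplit (↥(maximalRealSubfield L)) L (IsCMField.complexConj L) 3).Adelic, borelConstantTerm ν₀ 𝓕₀ Φ g = 0)
    (𝔓 : (quasiSplit (↥(maximalRealSubfield L)) L (IsCMField.complexConj L) 3).ParabolicUnipotentData) (j : 𝔓.ι)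
    (h𝔓 : 𝔓.radical j = adelicUnipotent (↥(maximalRealSubfield L)) L (IsCMField.complexConj L) 3) :
    ConstantTermVanishes 𝔓 ((quasiSplit (↥(maximalRealSubfield L)) L (IsCMField.complexConj L) 3).quotFun Φ) j := by
  have hc : IsCMField.complexConj L * IsCMField.complexConj L = 1 := AlgEquiv.ext fun x => IsCMField.complexConj_apply_apply L x
  -- the vanishing of ONE constant term of the descent: `quotFun Φ [x u⁻¹] = Φ (u x⁻¹)`
  have hzero : ∀ x : (quasiSplit (↥(maximalRealSubfield L)) L (IsCMField.complexConj L) 3).Adelic,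
      ∫ u in 𝓕₀, (quasiSplit (↥(maximalRealSubfield L)) L (IsCMField.complexConj L) 3).quotFun Φ
        ((quasiSplit (↥(maximalRealSubfield L)) L (IsCMField.complexConj L) 3).toAutomorphicQuotient
          (x * ((u : (quasiSplit (↥(maximalRealSubfield L)) L (IsCMField.complexConj L) 3).Adelic))⁻¹)) ∂ν₀ = 0 := by
    intro x
    have heq : (fun u : ↥(adelicUnipotent (↥(maximalRealSubfield L)) L (IsCMField.complexConj L) 3) =>
        (quasiSplit (↥(maximalRealSubfield L)) L (IsCMField.complexConj L) 3).quotFun Φ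
          ((quasiSplit (↥(maximalRealSubfield L)) L (IsCMField.complexConj L) 3).toAutomorphicQuotient
            (x * ((u : (quasiSplit (↥(maximalRealSubfield L)) L (IsCMField.complexConj L) 3).Adelic))⁻¹))) =
        fun u : ↥(adelicUnipotent (↥(maximalRealSubfield L)) L (IsCMField.complexConj L) 3) =>
          Φ ((u : (quasiSplit (↥(maximalRealSubfield L)) L (IsCMField.complexConj L) 3).Adelic) * x⁻¹) := by
      funext u
      rw [AdelicGroupData.quotFun_toAutomorphicQuotient hΦinv, mul_inv_rev, inv_inv]
    have hct := hCT x⁻¹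
    rw [borelConstantTerm_def, smul_eq_zero] at hct
    rcases hct with h | h
    · exact absurd h (inv_ne_zero (ENNReal.toReal_ne_zero.2 ⟨h𝓕₀0, h𝓕₀top⟩))
    · rw [heq]
      exact h
  -- the generic-radical form: for a subgroup EQUAL to `N(𝔸)`, the unfolded `ConstantTermVanishes` statement
  have key : ∀ R : Subgroup (quasiSplit (↥(maximalRealSubfield L)) L (IsCMField.complexConj L) 3).Adelic,
      R = adelicUnipotent (↥(maximalRealSubfield L)) L (IsCMField.complexConj L) 3 →
      ∀ [MeasurableSpace ↥R] [BorelSpace ↥R] (ν : Measure ↥R) [ν.IsHaarMeasure] (𝓕 : Set ↥R),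
        IsFundamentalDomain ↥(((quasiSplit (↥(maximalRealSubfield L)) L (IsCMField.complexConj L) 3).arithmeticSubgroup).comap R.subtype) 𝓕 ν →
        ∀ x : (quasiSplit (↥(maximalRealSubfield L)) L (IsCMField.complexConj L) 3).Adelic,
          IntegrableOn (fun u : ↥R => (quasiSplit (↥(maximalRealSubfield L)) L (IsCMField.complexConj L) 3).quotFun Φ
            ((quasiSplit (↥(maximalRealSubfield L)) L (IsCMField.complexConj L) 3).toAutomorphicQuotient
              (x * ((u : (quasiSplit (↥(maximalRealSubfield L)) L (IsCMField.complexConj L) 3).Adelic))⁻¹))) 𝓕 ν ∧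
          ∫ u in 𝓕, (quasiSplit (↥(maximalRealSubfield L)) L (IsCMField.complexConj L) 3).quotFun Φ
            ((quasiSplit (↥(maximalRealSubfield L)) L (IsCMField.complexConj L) 3).toAutomorphicQuotient
              (x * ((u : (quasiSplit (↥(maximalRealSubfield L)) L (IsCMField.complexConj L) 3).Adelic))⁻¹)) ∂ν = 0 := by
    rintro R rfl
    obtain ⟨h₁, h₂⟩ := locallyCompactSpace_and_secondCountableTopology_adelicUnipotent (F := ↥(maximalRealSubfield L)) (E := L) (c := IsCMField.complexConj L) (N := 3)
    haveI : LocallyCompactSpace ↥((⟨PUnit, fun _ => adelicUnipotent (↥(maximalRealSubfield L)) L (IsCMField.complexConj L) 3⟩ :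
        (quasiSplit (↥(maximalRealSubfield L)) L (IsCMField.complexConj L) 3).ParabolicUnipotentData).radical PUnit.unit) := h₁
    haveI : SecondCountableTopology ↥((⟨PUnit, fun _ => adelicUnipotent (↥(maximalRealSubfield L)) L (IsCMField.complexConj L) 3⟩ :
        (quasiSplit (↥(maximalRealSubfield L)) L (IsCMField.complexConj L) 3).ParabolicUnipotentData).radical PUnit.unit) := h₂
    haveI : Countable ↥((⟨PUnit, fun _ => adelicUnipotent (↥(maximalRealSubfield L)) L (IsCMField.complexConj L) 3⟩ :
        (quasiSplit (↥(maximalRealSubfield L)) L (IsCMField.complexConj L) 3).ParabolicUnipotentData).rational PUnit.unit) := by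
      haveI : Countable (quasiSplit (↥(maximalRealSubfield L)) L (IsCMField.complexConj L) 3).arithmeticSubgroup := countable_arithmeticSubgroup_quasiSplit
      have hinj : Function.Injective (fun γ : ↥(rationalUnipotent (↥(maximalRealSubfield L)) L (IsCMField.complexConj L) 3) =>
          (⟨((γ : ↥(adelicUnipotent (↥(maximalRealSubfield L)) L (IsCMField.complexConj L) 3)) : (quasiSplit (↥(maximalRealSubfield L)) L (IsCMField.complexConj L) 3).Adelic), γ.2⟩ :
            (quasiSplit (↥(maximalRealSubfield L)) L (IsCMField.complexConj L) 3).arithmeticSubgroup)) := by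
        intro a b h
        exact Subtype.ext (Subtype.ext (congrArg (fun z : (quasiSplit (↥(maximalRealSubfield L)) L (IsCMField.complexConj L) 3).arithmeticSubgroup =>
          (z : (quasiSplit (↥(maximalRealSubfield L)) L (IsCMField.complexConj L) 3).Adelic)) h))
      exact hinj.countable
    obtain ⟨C, hC, hcov⟩ := exists_isCompact_rational_smul_mem_of_eq_three (F := ↥(maximalRealSubfield L)) (E := L) (c := IsCMField.complexConj L) hc
      (Nsub := adelicUnipotent (↥(maximalRealSubfield L)) L (IsCMField.complexConj L) 3) rfl
    intro m hm ν hν 𝓕 h𝓕 x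
    exact constantTermVanishes_of_setIntegral_eq_zero (quasiSplit (↥(maximalRealSubfield L)) L (IsCMField.complexConj L) 3)
      (⟨PUnit, fun _ => adelicUnipotent (↥(maximalRealSubfield L)) L (IsCMField.complexConj L) 3⟩ :
        (quasiSplit (↥(maximalRealSubfield L)) L (IsCMField.complexConj L) 3).ParabolicUnipotentData)
      (i := PUnit.unit) hC hcov ν₀ h𝓕₀ (AdelicGroupData.continuous_quotFun hΦinv hΦc) hzero ν 𝓕 h𝓕 x
  intro m hm ν hν 𝓕 h𝓕 x
  exact key (𝔓.radical j) h𝔓 ν 𝓕 h𝓕 x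

/-! ## §2 The class lies in `L²_cusp` -/

/-- **THE CLASS OF `Φ` IS CUSPIDAL**: with the hypotheses of §1 at EVERY index of `𝔓` (`h𝔓 : ∀ j, 𝔓.radical j = N(𝔸)` — the (R) socket's frame) and `quotFun Φ ∈ L²(μ)`, the descent
`quotFun Φ` is a continuous square-integrable cusp form (★ `mem_cuspForms`) and its class lies in `L²_cusp(𝔓)` (★ `toLp_mem_cuspidalSubspace`). [cite: BorelJacquet1979, §4.4–§4.6]
[cite: MoeglinWaldspurger1995, I.2.18] -/
theorem toLp_quotFun_mem_cuspidalSubspace_of_borelConstantTerm_eq_zero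
    (μ : Measure (quasiSplit (↥(maximalRealSubfield L)) L (IsCMField.complexConj L) 3).automorphicQuotient)
    [(quasiSplit (↥(maximalRealSubfield L)) L (IsCMField.complexConj L) 3).IsAutomorphicMeasure μ]
    {Φ : (quasiSplit (↥(maximalRealSubfield L)) L (IsCMField.complexConj L) 3).Adelic → ℂ} (hΦc : Continuous Φ)
    (hΦinv : ∀ γ ∈ (quasiSplit (↥(maximalRealSubfield L)) L (IsCMField.complexConj L) 3).quotientSubgroup,
      ∀ g : (quasiSplit (↥(maximalRealSubfield L)) L (IsCMField.complexConj L) 3).Adelic, Φ (γ * g) = Φ g)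
    (hΦ2 : MemLp ((quasiSplit (↥(maximalRealSubfield L)) L (IsCMField.complexConj L) 3).quotFun Φ) 2 μ)
    (ν₀ : Measure ↥(adelicUnipotent (↥(maximalRealSubfield L)) L (IsCMField.complexConj L) 3)) [ν₀.IsHaarMeasure]
    {𝓕₀ : Set ↥(adelicUnipotent (↥(maximalRealSubfield L)) L (IsCMField.complexConj L) 3)}
    (h𝓕₀ : IsFundamentalDomain ↥(rationalUnipotent (↥(maximalRealSubfield L)) L (IsCMField.complexConj L) 3) 𝓕₀ ν₀) (h𝓕₀0 : ν₀ 𝓕₀ ≠ 0) (h𝓕₀top : ν₀ 𝓕₀ ≠ ∞)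
    (hCT : ∀ g : (quasiSplit (↥(maximalRealSubfield L)) L (IsCMField.complexConj L) 3).Adelic, borelConstantTerm ν₀ 𝓕₀ Φ g = 0)
    (𝔓 : (quasiSplit (↥(maximalRealSubfield L)) L (IsCMField.complexConj L) 3).ParabolicUnipotentData)
    (h𝔓 : ∀ j : 𝔓.ι, 𝔓.radical j = adelicUnipotent (↥(maximalRealSubfield L)) L (IsCMField.complexConj L) 3) :
    hΦ2.toLp ((quasiSplit (↥(maximalRealSubfield L)) L (IsCMField.complexConj L) 3).quotFun Φ) ∈
      (quasiSplit (↥(maximalRealSubfield L)) L (IsCMField.complexConj L) 3).cuspidalSubspace μ 𝔓 := by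
  have hmem : (quasiSplit (↥(maximalRealSubfield L)) L (IsCMField.complexConj L) 3).quotFun Φ ∈
      (quasiSplit (↥(maximalRealSubfield L)) L (IsCMField.complexConj L) 3).cuspForms μ 𝔓 :=
    mem_cuspForms.2 ⟨AdelicGroupData.continuous_quotFun hΦinv hΦc, hΦ2, fun j =>
      constantTermVanishes_quotFun_of_borelConstantTerm_eq_zero L hΦc hΦinv ν₀ h𝓕₀ h𝓕₀0 h𝓕₀top hCT 𝔓 j (h𝔓 j)⟩
  exact toLp_mem_cuspidalSubspace hmem

/-! ## §3 KER ⊇: a residual class with vanishing Borel constant term is zero -/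

/-- **KER ⊇ — A RESIDUAL CLASS WITH VANISHING BOREL CONSTANT TERM IS ZERO.**  `Φ` continuous, left-`A_G·G(F)`-invariant, its class `f =ᵐ x ↦ Φ((out x)⁻¹)` (D1's `hf` shape; `= quotFun Φ`
definitionally), ONE Heisenberg package with `borelConstantTerm ν₀ 𝓕₀ Φ = 0`, and `f ∈ L²_res(𝔓)` for a parabolic datum all of whose radicals are `N(𝔸)` (the (R)′ conclusion applied to `f`):
then `f ∈ L²_cusp(𝔓)` (§2) and `L²_cusp ⟂ L²_res` (★ `isOrtho_cuspidalSubspace_residualSubspace`) force `⟪f, f⟫ = 0`, i.e. `f = 0` (the three lines of ★ `cuspidal_residual_exclusive`).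
[cite: MoeglinWaldspurger1995, I.2.18, V.3.13] [cite: Langlands1976, §7] -/
theorem res_class_eq_zero_of_borelConstantTerm_eq_zero
    (μ : Measure (quasiSplit (↥(maximalRealSubfield L)) L (IsCMField.complexConj L) 3).automorphicQuotient)
    [(quasiSplit (↥(maximalRealSubfield L)) L (IsCMField.complexConj L) 3).IsAutomorphicMeasure μ]
    {Φ : (quasiSplit (↥(maximalRealSubfield L)) L (IsCMField.complexConj L) 3).Adelic → ℂ} (hΦc : Continuous Φ)
    (hΦinv : ∀ γ ∈ (quasiSplit (↥(maximalRealSubfield L)) L (IsCMField.complexConj L) 3).quotientSubgroup,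
      ∀ g : (quasiSplit (↥(maximalRealSubfield L)) L (IsCMField.complexConj L) 3).Adelic, Φ (γ * g) = Φ g)
    (ν₀ : Measure ↥(adelicUnipotent (↥(maximalRealSubfield L)) L (IsCMField.complexConj L) 3)) [ν₀.IsHaarMeasure]
    {𝓕₀ : Set ↥(adelicUnipotent (↥(maximalRealSubfield L)) L (IsCMField.complexConj L) 3)}
    (h𝓕₀ : IsFundamentalDomain ↥(rationalUnipotent (↥(maximalRealSubfield L)) L (IsCMField.complexConj L) 3) 𝓕₀ ν₀) (h𝓕₀0 : ν₀ 𝓕₀ ≠ 0) (h𝓕₀top : ν₀ 𝓕₀ ≠ ∞)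
    (hCT : ∀ g : (quasiSplit (↥(maximalRealSubfield L)) L (IsCMField.complexConj L) 3).Adelic, borelConstantTerm ν₀ 𝓕₀ Φ g = 0)
    (𝔓 : (quasiSplit (↥(maximalRealSubfield L)) L (IsCMField.complexConj L) 3).ParabolicUnipotentData)
    (h𝔓 : ∀ j : 𝔓.ι, 𝔓.radical j = adelicUnipotent (↥(maximalRealSubfield L)) L (IsCMField.complexConj L) 3)
    {f : (quasiSplit (↥(maximalRealSubfield L)) L (IsCMField.complexConj L) 3).L2 μ}
    (hf : (f : (quasiSplit (↥(maximalRealSubfield L)) L (IsCMField.complexConj L) 3).automorphicQuotient → ℂ) =ᵐ[μ]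
      fun x => Φ (Quotient.out (x : (quasiSplit (↥(maximalRealSubfield L)) L (IsCMField.complexConj L) 3).Adelic ⧸
        (quasiSplit (↥(maximalRealSubfield L)) L (IsCMField.complexConj L) 3).quotientSubgroup))⁻¹)
    (hres : f ∈ (residualSubspace (quasiSplit (↥(maximalRealSubfield L)) L (IsCMField.complexConj L) 3) μ 𝔓).toSubmodule) :
    f = 0 := by
  -- the descent `quotFun Φ` IS the a.e. representative of `f`, hence square-integrable
  have hΦ2 : MemLp ((quasiSplit (↥(maximalRealSubfield L)) L (IsCMField.complexConj L) 3).quotFun Φ) 2 μ := (Lp.memLp f).ae_eq hf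
  have hcusp := toLp_quotFun_mem_cuspidalSubspace_of_borelConstantTerm_eq_zero L μ hΦc hΦinv hΦ2 ν₀ h𝓕₀ h𝓕₀0 h𝓕₀top hCT 𝔓 h𝔓
  have htoLp : hΦ2.toLp ((quasiSplit (↥(maximalRealSubfield L)) L (IsCMField.complexConj L) 3).quotFun Φ) = f :=
    Lp.ext ((MemLp.coeFn_toLp hΦ2).trans hf.symm)
  rw [htoLp] at hcusp
  have hO := isOrtho_cuspidalSubspace_residualSubspace (quasiSplit (↥(maximalRealSubfield L)) L (IsCMField.complexConj L) 3) μ 𝔓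
  have h0 : inner ℂ f f = 0 := Submodule.inner_right_of_mem_orthogonal hres (hO hcusp)
  exact inner_self_eq_zero.mp h0

/-! ## §4 The RES-INT kernel statement at one generator: `f = 0 ↔ ρψ = 0` -/

/-- **KER — THE RESIDUE CLASS AT THE MIDDLE POLE VANISHES IFF `ρψ = ρ·φt(3∕2)` DOES** (`ker Res = ker M₋₁` at one generator).  HYPOTHESES = ★ CT-RES's binders byte for byte (ESTATE T's
clauses `hPdisc hEcA hEcc hE2bd`, D1's pole letter `Fp hFp hFpE`, ℓ-CT's package `φ ψ ρψ hCT hρψ` at ONE Heisenberg package `(ν₀, 𝓕₀)` — `𝓕₀` a fundamental domain with compact closure and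
`0 < ν₀𝓕₀ < ∞`) + the left-`A_G·G(F)`-invariance of the residue function (`hinv`, ★ `midPoleLetter_apply_quotientSubgroup_mul` on D1's clauses) + D1's class `f` (`hf`) + the (R)′
conclusion APPLIED TO `f`: `hres : f ∈ residualSubspace μ 𝔓` (every radical of `𝔓` `= N(𝔸)`, the (R) socket's `h𝔓`).  CONCLUSION: `f = 0 ↔ ∀ g, ρψ g = 0`.  (⇐) ★ CT-RES gives
`borelConstantTerm ν₀ 𝓕₀ (Fp · (3∕2)) = 0`, then §3; (⇒) `f = 0` makes the continuous descent vanish a.e., hence everywhere (`μ` positive on opens), so `Fp g (3∕2) = 0` for all `g`, the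
constant term vanishes, and ★ CT-RES reads `ρψ g·H(g)^{2−3∕2} = 0` with `H(g) > 0` (★ `borelHeight_pos`). [cite: MoeglinWaldspurger1995, I.2.18, IV.1.11, V.3.13] [cite: Langlands1976, §7] -/
theorem res_class_eq_zero_iff_rhoPsi_eq_zero
    (μ : Measure (quasiSplit (↥(maximalRealSubfield L)) L (IsCMField.complexConj L) 3).automorphicQuotient)
    [(quasiSplit (↥(maximalRealSubfield L)) L (IsCMField.complexConj L) 3).IsAutomorphicMeasure μ]
    (ν₀ : Measure ↥(adelicUnipotent (↥(maximalRealSubfield L)) L (IsCMField.complexConj L) 3)) [ν₀.IsHaarMeasure]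
    {𝓕₀ : Set ↥(adelicUnipotent (↥(maximalRealSubfield L)) L (IsCMField.complexConj L) 3)}
    (h𝓕₀ : IsFundamentalDomain ↥(rationalUnipotent (↥(maximalRealSubfield L)) L (IsCMField.complexConj L) 3) 𝓕₀ ν₀) (h𝓕₀c : IsCompact (closure 𝓕₀))
    (h𝓕₀0 : ν₀ 𝓕₀ ≠ 0) (h𝓕₀top : ν₀ 𝓕₀ ≠ ∞)
    (Ec : ℂ → (quasiSplit (↥(maximalRealSubfield L)) L (IsCMField.complexConj L) 3).Adelic → ℂ) (P : Set ℂ)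
    (hPdisc : ∀ᶠ s in 𝓝[≠] ((3 : ℂ) / 2), s ∉ P)
    (hEcA : ∀ g (z : ℂ), z ∉ P → AnalyticAt ℂ (fun z => Ec z g) z)
    (hEcc : ∀ z : ℂ, z ∉ P → Continuous (Ec z))
    (hE2bd : ∀ z₁ : ℂ, z₁ ∉ P → ∀ K : Set (quasiSplit (↥(maximalRealSubfield L)) L (IsCMField.complexConj L) 3).Adelic, IsCompact K →
      ∃ V ∈ 𝓝 z₁, ∃ M : ℝ, ∀ z ∈ V, ∀ g ∈ K, ‖Ec z g‖ ≤ M)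
    (Fp : (quasiSplit (↥(maximalRealSubfield L)) L (IsCMField.complexConj L) 3).Adelic → ℂ → ℂ) (hFp : ∀ g, AnalyticAt ℂ (Fp g) ((3 : ℂ) / 2))
    (hFpE : ∀ g, Fp g =ᶠ[𝓝[≠] ((3 : ℂ) / 2)] fun z => (z - (3 : ℂ) / 2) * Ec z g)
    (hinv : ∀ γ ∈ (quasiSplit (↥(maximalRealSubfield L)) L (IsCMField.complexConj L) 3).quotientSubgroup,
      ∀ g : (quasiSplit (↥(maximalRealSubfield L)) L (IsCMField.complexConj L) 3).Adelic, Fp (γ * g) ((3 : ℂ) / 2) = Fp g ((3 : ℂ) / 2))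
    (φ : (quasiSplit (↥(maximalRealSubfield L)) L (IsCMField.complexConj L) 3).Adelic → ℂ) (ψ : ℂ → (quasiSplit (↥(maximalRealSubfield L)) L (IsCMField.complexConj L) 3).Adelic → ℂ)
    (ρψ : (quasiSplit (↥(maximalRealSubfield L)) L (IsCMField.complexConj L) 3).Adelic → ℂ)
    (hCT : ∀ᶠ z in 𝓝[≠] ((3 : ℂ) / 2), ∀ g : (quasiSplit (↥(maximalRealSubfield L)) L (IsCMField.complexConj L) 3).Adelic,
      borelConstantTerm ν₀ 𝓕₀ (Ec z) g = φ g * (((borelHeight g : ℝ≥0) : ℝ) : ℂ) ^ z + ψ z g * (((borelHeight g : ℝ≥0) : ℝ) : ℂ) ^ (2 - z))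
    (hρψ : ∀ g, Tendsto (fun z : ℂ => (z - (3 : ℂ) / 2) * ψ z g) (𝓝[≠] ((3 : ℂ) / 2)) (𝓝 (ρψ g)))
    (𝔓 : (quasiSplit (↥(maximalRealSubfield L)) L (IsCMField.complexConj L) 3).ParabolicUnipotentData)
    (h𝔓 : ∀ j : 𝔓.ι, 𝔓.radical j = adelicUnipotent (↥(maximalRealSubfield L)) L (IsCMField.complexConj L) 3)
    {f : (quasiSplit (↥(maximalRealSubfield L)) L (IsCMField.complexConj L) 3).L2 μ}
    (hf : (f : (quasiSplit (↥(maximalRealSubfield L)) L (IsCMField.complexConj L) 3).automorphicQuotient → ℂ) =ᵐ[μ]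
      fun x => Fp (Quotient.out (x : (quasiSplit (↥(maximalRealSubfield L)) L (IsCMField.complexConj L) 3).Adelic ⧸
        (quasiSplit (↥(maximalRealSubfield L)) L (IsCMField.complexConj L) 3).quotientSubgroup))⁻¹ ((3 : ℂ) / 2))
    (hres : f ∈ (residualSubspace (quasiSplit (↥(maximalRealSubfield L)) L (IsCMField.complexConj L) 3) μ 𝔓).toSubmodule) :
    f = 0 ↔ ∀ g : (quasiSplit (↥(maximalRealSubfield L)) L (IsCMField.complexConj L) 3).Adelic, ρψ g = 0 := by
  -- CT-RES at the package `(ν₀, 𝓕₀)`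
  haveI : IsFiniteMeasureOnCompacts ν₀ := inferInstance
  have hCTres : ∀ g : (quasiSplit (↥(maximalRealSubfield L)) L (IsCMField.complexConj L) 3).Adelic,
      borelConstantTerm ν₀ 𝓕₀ (fun y => Fp y ((3 : ℂ) / 2)) g = ρψ g * (((borelHeight g : ℝ≥0) : ℝ) : ℂ) ^ (2 - (3 : ℂ) / 2) := fun g =>
    borelConstantTerm_midPoleLetter_eq L ν₀ h𝓕₀.nullMeasurableSet h𝓕₀c Ec P hPdisc hEcA hEcc hE2bd Fp hFp hFpE φ ψ ρψ hCT hρψ g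
  have hΦc : Continuous fun y : (quasiSplit (↥(maximalRealSubfield L)) L (IsCMField.complexConj L) 3).Adelic => Fp y ((3 : ℂ) / 2) :=
    continuous_midPoleLetter_apply L Ec P hPdisc hEcA hEcc hE2bd Fp hFp hFpE
  constructor
  · -- (⇒) `f = 0` ⇒ the residue function vanishes ⇒ its constant term vanishes ⇒ `ρψ = 0`
    intro hf0 g
    have hae : (quasiSplit (↥(maximalRealSubfield L)) L (IsCMField.complexConj L) 3).quotFun
        (fun y : (quasiSplit (↥(maximalRealSubfield L)) L (IsCMField.complexConj L) 3).Adelic => Fp y ((3 : ℂ) / 2)) =ᵐ[μ]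
        (fun _ => (0 : ℂ)) := by
      have h1 : ((f : (quasiSplit (↥(maximalRealSubfield L)) L (IsCMField.complexConj L) 3).L2 μ) :
          (quasiSplit (↥(maximalRealSubfield L)) L (IsCMField.complexConj L) 3).automorphicQuotient → ℂ) =ᵐ[μ] (fun _ => (0 : ℂ)) := by
        rw [hf0]
        exact Lp.coeFn_zero _ _ _
      exact hf.symm.trans h1
    have hzero : (quasiSplit (↥(maximalRealSubfield L)) L (IsCMField.complexConj L) 3).quotFun
        (fun y : (quasiSplit (↥(maximalRealSubfield L)) L (IsCMField.complexConj L) 3).Adelic => Fp y ((3 : ℂ) / 2)) = fun _ => (0 : ℂ) :=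
      (Continuous.ae_eq_iff_eq μ (AdelicGroupData.continuous_quotFun hinv hΦc) continuous_const).1 hae
    have hΦ0 : ∀ y : (quasiSplit (↥(maximalRealSubfield L)) L (IsCMField.complexConj L) 3).Adelic, Fp y ((3 : ℂ) / 2) = 0 := by
      intro y
      have h := congrFun hzero ((quasiSplit (↥(maximalRealSubfield L)) L (IsCMField.complexConj L) 3).toAutomorphicQuotient y⁻¹)
      rw [AdelicGroupData.quotFun_toAutomorphicQuotient hinv, inv_inv] at h
      exact h
    have hct0 : borelConstantTerm ν₀ 𝓕₀ (fun y => Fp y ((3 : ℂ) / 2)) g = 0 := by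
      rw [borelConstantTerm_def]
      simp only [hΦ0, integral_zero, smul_zero]
    have hH0 : ((((borelHeight g : ℝ≥0) : ℝ) : ℂ)) ≠ 0 := by exact_mod_cast (borelHeight_pos g).ne'
    have h := hCTres g
    rw [hct0, eq_comm, mul_eq_zero] at h
    rcases h with h | h
    · exact h
    · exact absurd h (by rw [Complex.cpow_eq_zero_iff, not_and_or]; exact Or.inl hH0)
  · -- (⇐) `ρψ = 0` ⇒ the constant term of the residue function vanishes (CT-RES) ⇒ `f = 0` (§3)
    intro hρ0
    refine res_class_eq_zero_of_borelConstantTerm_eq_zero L μ hΦc hinv ν₀ h𝓕₀ h𝓕₀0 h𝓕₀top (fun g => ?_) 𝔓 h𝔓 hf hres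
    rw [hCTres g, hρ0 g, zero_mul]

end Summit.HodgeConjecture.HodgeConjecture.R90.S8

end
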